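/-
Copyright (c) 2026 the pub-hodgecm-mathlib formalisation cell (harness21).  Prover seat hodgecm-mathlib-LH7-p07 (g0), Track A «(D-RAM) FOUR-FRAME» squad, helper lane on
h413 = stmt-HodgeConjecture-24833 (count-neutral).  β-BOARD chair F0P3a-p01 (g37) 16:41:58Z (T1)(T2)(T3): the tower-sign TOKENS of the rescaled datum `(α⁻¹, β·α⁻¹; n₃, n₂, n₁)`
of ★ p862014's `(0 2)`-transport.  2026-09-04.
-/
import Literature.NumberTheory.Automorphic.UnitaryThreeFourFrameDefs        -- ★: `IsRamifiedQuadraticDatum`, `IsElementDatum`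
import Literature.NumberTheory.LocalFields.WildQuadraticDatumRefSkewScalar  -- ★: `v_refSkewScalar`
import HarnessLib

/-!
# Crux `H413`, line LH4 «(D-RAM) FOUR-FRAME» — β-BOARD: THE TOWER-SIGN TOKENS OF THE RESCALED DATUM `(α⁻¹, β·α⁻¹; n₃, n₂, n₁)` (companion of ★ p862014)

Cell `hodgecm-mathlib` (D-0151), FLOOR 0, crux item H413 = `stmt-HodgeConjecture-24833`, route `HCCMUnconditional`; squad F0∕P3c∕LH4.  THEOREMS ONLY (no `def`, no instance, no
notation, no `sorry`, default heartbeats); ★-only imports; lane `--supports stmt-HodgeConjecture-24833 --as helper` (count-neutral); pays NO row, states NO law.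

WHY (chair F0P3a-p01 (g37), 2026-09-04 16:41:58Z).  ★ p862014 `…LabelledOddTowerThreeOfTowerOne.finsum_stratum_shell_labelledOdd_div_relIndex_swap02_of` carries every tower-1 row
of the labelled-odd (β) table to the tower-3 row at the RESCALED datum `(α″, β″) = (α⁻¹, β·α⁻¹)` with depths `(n₃, n₂, n₁)`.  The κ-line rows are stated with TOWER-SIGN TOKENS as
auxiliary witnesses — `|(ϖ^N)⁻¹·(x·X − e·Y)| ≤ 1`, `Y = t₊ = (ϖ − σϖ)·((ϖσϖ)^{(d − d%2)∕2})⁻¹` the reference skew scalar (`|Y| = |ϖ|^{d%2}`, ★ `v_refSkewScalar`), `X` a power of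
`(ϖσϖ)⁻¹`, `e` a sign unit — for `x = α − 1` (`eA`), `x = β − 1` (`eB`), `x = α − β` (`eC`).  The rescaled datum's three differences are UNIT MULTIPLES of these:
`α″ − 1 = α⁻¹ − 1 = α⁻¹·(−(α − 1))`, `β″ − α″ = (β − 1)·α⁻¹`, `β″ − 1 = α⁻¹·(−(α − β))`, with the unit `α⁻¹ ≡ 1 (ϖ^{n₂})`, `n₂ ≥ N₀ ≥ N`.  A token is blind to multiplying `x`
by a unit `u` with `|u − 1| ≤ |ϖ^N|` (`(ux)X − eY = u(xX − eY) + (u − 1)eY`, `|eY| ≤ 1`) and flips its sign with `x`.  Hence (T1) the token of `α⁻¹ − 1` is `−eA`, (T2) the token of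
`β·α⁻¹ − α⁻¹` is `eB`, (T3) the token of `β·α⁻¹ − 1` is `−eC` — at the same `X` and `N`.
WHAT IS PROVED.  §1 `token_neg`, `token_mul_of_v_sub_one_le` (generic, any `X Y`); §2 at an element datum over the place datum (`N ≤ N₀`, `|e| ≤ 1`):
**`token_inv_sub_one_of_token_sub_one`** (T1), **`token_mul_inv_sub_inv_of_token_sub_one`** (T2), **`token_mul_inv_sub_one_of_token_sub`** (T3).
HONEST LABEL.  Valuation bookkeeping; count-neutral (`--supports`); pays no registered stub, touches no `Lines/` module, states no census law; `hκ₃`∕`hRest`∕(β-BAL)∕(β)∕T₊ remain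
OPEN; `HC_CM` is proved only modulo the 7 printed citations (2 remaining named inputs: hLiu418 = `stmt-HodgeConjecture-24832`, h413 = `stmt-HodgeConjecture-24833`) until rung 0 closes.

## References
* [Rogawski1990] J. D. Rogawski, *Automorphic Representations of Unitary Groups in Three Variables*, Ann. of Math. Stud. 123 (1990), §4.9 p. 55 (the element datum and its depths).
* [Serre1979] J.-P. Serre, *Local Fields*, GTM 67 (1979), Ch. III §6 Prop. 13 (the different of a ramified quadratic extension), Ch. V §3 Cor. 3.
-/

set_option autoImplicit false

namespace Summit.HodgeConjecture.HodgeConjecture.Cruxes.H413.F0P3cDyRamTowerSignTokenRescale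

open WithZero
open scoped Valued
open Literature.NumberTheory.Automorphic.UnitaryThreeFourFrame
open Literature.NumberTheory.LocalFields.WildQuadraticDatum (v_refSkewScalar)

variable {K : Type} [Field K] [Valued K ℤᵐ⁰] {σ : K →+* K} {ϖ : K} {d t : ℕ}

/-! ## §1  Generic token moves -/

/-- **A TOKEN FLIPS ITS SIGN WITH `x`**: `|(ϖ^N)⁻¹(x·X − e·Y)| ≤ 1 → |(ϖ^N)⁻¹((−x)·X − (−e)·Y)| ≤ 1`. [cite: Serre1979, Ch. V §3 Cor. 3] -/
theorem token_neg {N : ℕ} {x X e Y : K} (h : Valued.v ((ϖ ^ N)⁻¹ * (x * X - e * Y)) ≤ 1) :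
    Valued.v ((ϖ ^ N)⁻¹ * ((-x) * X - (-e) * Y)) ≤ 1 := by
  rw [show (ϖ ^ N)⁻¹ * ((-x) * X - (-e) * Y) = -((ϖ ^ N)⁻¹ * (x * X - e * Y)) by ring, Valuation.map_neg]
  exact h

/-- **A TOKEN IS BLIND TO A UNIT FACTOR `u ≡ 1 (ϖ^N)` ON `x`**: `|(ϖ^N)⁻¹(x·X − e·Y)| ≤ 1`, `|u| ≤ 1`, `|u − 1| ≤ |ϖ^N|`, `|e·Y| ≤ 1` ⇒ `|(ϖ^N)⁻¹((u·x)·X − e·Y)| ≤ 1`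
(`(ux)X − eY = u(xX − eY) + (u − 1)eY`). [cite: Serre1979, Ch. V §3 Cor. 3] -/
theorem token_mul_of_v_sub_one_le {N : ℕ} (hϖN : (ϖ ^ N : K) ≠ 0) {x X e Y u : K} (h : Valued.v ((ϖ ^ N)⁻¹ * (x * X - e * Y)) ≤ 1)
    (hu : Valued.v u ≤ 1) (hu1 : Valued.v (u - 1) ≤ Valued.v (ϖ ^ N)) (heY : Valued.v (e * Y) ≤ 1) :
    Valued.v ((ϖ ^ N)⁻¹ * ((u * x) * X - e * Y)) ≤ 1 := by
  have hvN : Valued.v (ϖ ^ N) ≠ 0 := (Valuation.ne_zero_iff _).2 hϖN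
  rw [show (ϖ ^ N)⁻¹ * ((u * x) * X - e * Y) = u * ((ϖ ^ N)⁻¹ * (x * X - e * Y)) + (ϖ ^ N)⁻¹ * (u - 1) * (e * Y) by ring]
  refine (Valuation.map_add _ _ _).trans (max_le ?_ ?_)
  · rw [map_mul]; exact mul_le_one' hu h
  · rw [map_mul, map_mul, map_inv₀]
    refine mul_le_one' ?_ heY
    calc (Valued.v (ϖ ^ N))⁻¹ * Valued.v (u - 1) ≤ (Valued.v (ϖ ^ N))⁻¹ * Valued.v (ϖ ^ N) := mul_le_mul' le_rfl hu1
      _ = 1 := inv_mul_cancel₀ hvN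

/-! ## §2  The three tokens of the rescaled datum -/

section Datum

variable {N₀ n₁ n₂ n₃ : ℕ} {α β : K}

/-- Letters of the datum: `ϖ^N ≠ 0`, `|α⁻¹| ≤ 1`, `|α⁻¹ − 1| ≤ |ϖ^N|` for `N ≤ N₀ ≤ n₂`, and `|e·t₊| ≤ 1` for `|e| ≤ 1`. [cite: Rogawski1990, §4.9 p. 55] [cite: Serre1979, Ch. III §6 Prop. 13] -/
theorem rescale_letters (hD : IsRamifiedQuadraticDatum σ ϖ d t) (hE : IsElementDatum σ ϖ N₀ α β n₁ n₂ n₃) {N : ℕ} (hN : N ≤ N₀) {e : K} (he : Valued.v e ≤ 1) :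
    (ϖ ^ N : K) ≠ 0 ∧ Valued.v α⁻¹ ≤ 1 ∧ Valued.v (α⁻¹ - 1) ≤ Valued.v (ϖ ^ N) ∧
      Valued.v (e * ((ϖ - σ ϖ) * ((ϖ * σ ϖ) ^ ((d - d % 2) / 2))⁻¹)) ≤ 1 := by
  obtain ⟨-, hvσ, hϖ, -, hdd, -, -⟩ := hD
  have hϖ0 : ϖ ≠ 0 := (Valuation.ne_zero_iff Valued.v).1 (by rw [hϖ]; exact exp_ne_zero)
  have hϖ1 : Valued.v ϖ ≤ 1 := by rw [hϖ, ← exp_zero, exp_le_exp]; norm_num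
  have hαn : α * σ α = 1 := hE.1
  have hα0 : α ≠ 0 := fun h => by rw [h, zero_mul] at hαn; exact zero_ne_one hαn
  have hα : Valued.v α = 1 := by
    have h : Valued.v α * Valued.v α = 1 := by nth_rw 2 [← hvσ α]; rw [← map_mul, hαn, map_one]
    rw [← pow_two] at h
    exact ((pow_eq_one_iff).1 h).resolve_right two_ne_zero
  have hαi : Valued.v α⁻¹ = 1 := by rw [map_inv₀, hα, inv_one]
  have hN₂ : N ≤ n₂ := hN.trans hE.2.2.2.2.2.2.2.2.2.1
  refine ⟨pow_ne_zero N hϖ0, hαi.le, ?_, ?_⟩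
  · rw [show α⁻¹ - 1 = -(α⁻¹ * (α - 1)) by rw [mul_sub, inv_mul_cancel₀ hα0, mul_one, neg_sub], Valuation.map_neg, map_mul, hαi, one_mul, hE.2.2.2.2.2.2.1, map_pow]
    exact pow_le_pow_right_of_le_one' hϖ1 hN₂
  · rw [map_mul, v_refSkewScalar hvσ hϖ hdd]
    exact mul_le_one' he (by rw [← exp_zero, exp_le_exp]; omega)

/-- **(T1) THE TOKEN OF `α″ − 1 = α⁻¹ − 1` IS `−eA`**: from the token of `α − 1` (sign `eA`, `|eA| ≤ 1`, any `X`, precision `N ≤ N₀`).  (`α⁻¹ − 1 = α⁻¹·(−(α − 1))`.)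
[cite: Rogawski1990, §4.9 p. 55] [cite: Serre1979, Ch. V §3 Cor. 3] -/
theorem token_inv_sub_one_of_token_sub_one (hD : IsRamifiedQuadraticDatum σ ϖ d t) (hE : IsElementDatum σ ϖ N₀ α β n₁ n₂ n₃) {N : ℕ} (hN : N ≤ N₀)
    {eA : K} (heA : Valued.v eA ≤ 1) (X : K)
    (h : Valued.v ((ϖ ^ N)⁻¹ * ((α - 1) * X - eA * ((ϖ - σ ϖ) * ((ϖ * σ ϖ) ^ ((d - d % 2) / 2))⁻¹))) ≤ 1) :
    Valued.v ((ϖ ^ N)⁻¹ * ((α⁻¹ - 1) * X - (-eA) * ((ϖ - σ ϖ) * ((ϖ * σ ϖ) ^ ((d - d % 2) / 2))⁻¹))) ≤ 1 := by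
  have hα0 : α ≠ 0 := fun h0 => by have := hE.1; rw [h0, zero_mul] at this; exact zero_ne_one this
  obtain ⟨hϖN, hαi, hαi1, heY⟩ := rescale_letters hD hE hN (e := -eA) (by rw [Valuation.map_neg]; exact heA)
  have h' := token_mul_of_v_sub_one_le hϖN (token_neg h) hαi hαi1 heY
  rwa [show α⁻¹ * (-(α - 1)) = α⁻¹ - 1 by rw [mul_neg, mul_sub, inv_mul_cancel₀ hα0, mul_one, neg_sub]] at h'

/-- **(T2) THE TOKEN OF `β″ − α″ = β·α⁻¹ − α⁻¹` IS `eB`**: from the token of `β − 1` (sign `eB`, `|eB| ≤ 1`, any `X`, precision `N ≤ N₀`).  (`β·α⁻¹ − α⁻¹ = α⁻¹·(β − 1)`.)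
[cite: Rogawski1990, §4.9 p. 55] [cite: Serre1979, Ch. V §3 Cor. 3] -/
theorem token_mul_inv_sub_inv_of_token_sub_one (hD : IsRamifiedQuadraticDatum σ ϖ d t) (hE : IsElementDatum σ ϖ N₀ α β n₁ n₂ n₃) {N : ℕ} (hN : N ≤ N₀)
    {eB : K} (heB : Valued.v eB ≤ 1) (X : K)
    (h : Valued.v ((ϖ ^ N)⁻¹ * ((β - 1) * X - eB * ((ϖ - σ ϖ) * ((ϖ * σ ϖ) ^ ((d - d % 2) / 2))⁻¹))) ≤ 1) :
    Valued.v ((ϖ ^ N)⁻¹ * ((β * α⁻¹ - α⁻¹) * X - eB * ((ϖ - σ ϖ) * ((ϖ * σ ϖ) ^ ((d - d % 2) / 2))⁻¹))) ≤ 1 := by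
  obtain ⟨hϖN, hαi, hαi1, heY⟩ := rescale_letters hD hE hN heB
  have h' := token_mul_of_v_sub_one_le hϖN h hαi hαi1 heY
  rwa [show α⁻¹ * (β - 1) = β * α⁻¹ - α⁻¹ by ring] at h'

/-- **(T3) THE TOKEN OF `β″ − 1 = β·α⁻¹ − 1` IS `−eC`**: from the token of `α − β` (sign `eC`, `|eC| ≤ 1`, any `X`, precision `N ≤ N₀`).  (`β·α⁻¹ − 1 = α⁻¹·(−(α − β))`.)
[cite: Rogawski1990, §4.9 p. 55] [cite: Serre1979, Ch. V §3 Cor. 3] -/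
theorem token_mul_inv_sub_one_of_token_sub (hD : IsRamifiedQuadraticDatum σ ϖ d t) (hE : IsElementDatum σ ϖ N₀ α β n₁ n₂ n₃) {N : ℕ} (hN : N ≤ N₀)
    {eC : K} (heC : Valued.v eC ≤ 1) (X : K)
    (h : Valued.v ((ϖ ^ N)⁻¹ * ((α - β) * X - eC * ((ϖ - σ ϖ) * ((ϖ * σ ϖ) ^ ((d - d % 2) / 2))⁻¹))) ≤ 1) :
    Valued.v ((ϖ ^ N)⁻¹ * ((β * α⁻¹ - 1) * X - (-eC) * ((ϖ - σ ϖ) * ((ϖ * σ ϖ) ^ ((d - d % 2) / 2))⁻¹))) ≤ 1 := by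
  have hα0 : α ≠ 0 := fun h0 => by have := hE.1; rw [h0, zero_mul] at this; exact zero_ne_one this
  obtain ⟨hϖN, hαi, hαi1, heY⟩ := rescale_letters hD hE hN (e := -eC) (by rw [Valuation.map_neg]; exact heC)
  have h' := token_mul_of_v_sub_one_le hϖN (token_neg h) hαi hαi1 heY
  rwa [show α⁻¹ * (-(α - β)) = β * α⁻¹ - 1 by rw [mul_neg, mul_sub, inv_mul_cancel₀ hα0, mul_comm, neg_sub]] at h'

end Datum

end Summit.HodgeConjecture.HodgeConjecture.Cruxes.H413.F0P3cDyRamTowerSignTokenRescale
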